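import Summits.CriticalPhenomena.CardyFormulaZ2.Theorems.CardySelfDualSegmentUniformMarginalityBasePointTransportParam
import Summits.CriticalPhenomena.CardyFormulaZ2.Theorems.CardySelfDualSegmentUniformMarginalityFixedDomainContinuityZero

/-!
# The crux at the Smirnov point, reduced to tame domains (line `Sketch`, crux `UniformMarginality`, stmt-CriticalPhenomena-5472)

Specialisation of the one-parameter transport `integratedBoundAtParam_of_fixedDomainContinuity`
(`…BasePointTransportParam.lean`) at the base point `t₀ = 0`, where the fixed-parameter domain
continuity (B₂a″) is the landed theorem `fixedDomainContinuity_zero` (p116559: Smirnov's theorem for the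
sheared domains + Radó continuity of the Cardy value):

* `integratedBoundAtZero_of_rectilinear` — **at the Smirnov point the crux reduces to tame domains,
  unconditionally**: if `t ↦ P_t(Q,δ)` is continuous at `t = 0` uniformly in the mesh for every
  rectilinear conformal rectangle `Q`, then so it is for every conformal rectangle `R`;
* `uniformMarginalityAtZero_of_rectilinear` — the same in the crux's own vocabulary
  (`cornerCrossingProb`, `dist` on `unitInterval`).
-/

noncomputable section

namespace Summit.CriticalPhenomena.CardyFormulaZ2.Cruxes.UniformMarginality.HeatFlow

open MeasureTheory Literature.Probability.Percolation Literature.Probability.LatticeModels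
  Literature.Probability.RandomPlanarGeometry

/-- **At the Smirnov point the crux reduces to tame domains (unconditionally).** If for every
RECTILINEAR conformal rectangle `Q` the map `t ↦ P_t(Q,δ)` is continuous at `t = 0` uniformly in the
mesh, then the same holds for EVERY conformal rectangle: the fixed-parameter domain continuity at
`t₀ = 0` is the landed `fixedDomainContinuity_zero` (Smirnov's theorem for the sheared domains + Radó
continuity of the Cardy value). -/
theorem integratedBoundAtZero_of_rectilinear :
    (∀ R : ConformalRectangle,
      (∃ S : Finset (ℂ × ℂ), (∀ p ∈ S, p.1.re = p.2.re ∨ p.1.im = p.2.im) ∧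
        frontier R.carrier ⊆ ⋃ p ∈ S, segment ℝ p.1 p.2) →
      ∀ ε > 0, ∃ η > 0, ∀ δ : ℝ, 0 < δ → ∀ t ∈ Set.Icc (0 : ℝ) 1, |t - 0| < η →
        |Pext R δ t - Pext R δ 0| < ε) →
    ∀ R : ConformalRectangle, ∀ ε > 0, ∃ η > 0, ∀ δ : ℝ, 0 < δ → ∀ t ∈ Set.Icc (0 : ℝ) 1,
      |t - 0| < η → |Pext R δ t - Pext R δ 0| < ε :=
  fun hB => integratedBoundAtParam_of_fixedDomainContinuity 0 ⟨le_rfl, zero_le_one⟩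
    fixedDomainContinuity_zero hB

/-- **The crux at the base point, reduced to tame domains, in the crux's own vocabulary**: if
`UniformMarginality` holds at `t₀ = 0` for every rectilinear conformal rectangle, it holds at `t₀ = 0`
for every conformal rectangle — `∀ R ε, ∃ η, ∀ t, dist t 0 < η → ∀ δ > 0, |P_t(R,δ) − P_0(R,δ)| < ε`. -/
theorem uniformMarginalityAtZero_of_rectilinear :
    (∀ Q : ConformalRectangle,
      (∃ S : Finset (ℂ × ℂ), (∀ p ∈ S, p.1.re = p.2.re ∨ p.1.im = p.2.im) ∧
        frontier Q.carrier ⊆ ⋃ p ∈ S, segment ℝ p.1 p.2) →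
      ∀ ε > 0, ∃ η > 0, ∀ t : unitInterval, dist t 0 < η → ∀ δ : ℝ, 0 < δ →
        |cornerCrossingProb t Q δ - cornerCrossingProb 0 Q δ| < ε) →
    ∀ (R : ConformalRectangle) (ε : ℝ), 0 < ε → ∃ η > 0, ∀ t : unitInterval, dist t 0 < η →
      ∀ δ : ℝ, 0 < δ → |cornerCrossingProb t R δ - cornerCrossingProb 0 R δ| < ε := by
  intro hB
  -- translate the hypothesis to `Pext`
  have hB' : ∀ R : ConformalRectangle,
      (∃ S : Finset (ℂ × ℂ), (∀ p ∈ S, p.1.re = p.2.re ∨ p.1.im = p.2.im) ∧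
        frontier R.carrier ⊆ ⋃ p ∈ S, segment ℝ p.1 p.2) →
      ∀ ε > 0, ∃ η > 0, ∀ δ : ℝ, 0 < δ → ∀ t ∈ Set.Icc (0 : ℝ) 1, |t - 0| < η →
        |Pext R δ t - Pext R δ 0| < ε := by
    intro Q hQ ε hε
    obtain ⟨η, hη, h⟩ := hB Q hQ ε hε
    refine ⟨η, hη, fun δ hδ t ht htη => ?_⟩
    have hdist : dist (⟨t, ht⟩ : unitInterval) 0 < η := by
      rw [Subtype.dist_eq, Real.dist_eq]; exact htη
    have key := h ⟨t, ht⟩ hdist δ hδ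
    rw [← Pext_coe Q δ ⟨t, ht⟩, ← Pext_zero Q δ] at key
    exact key
  intro R ε hε
  obtain ⟨η, hη, h⟩ := integratedBoundAtZero_of_rectilinear hB' R ε hε
  refine ⟨η, hη, fun t ht δ hδ => ?_⟩
  have htη : |(t : ℝ) - 0| < η := by
    have := ht; rw [Subtype.dist_eq, Real.dist_eq] at this; exact this
  have key := h δ hδ (t : ℝ) t.2 htη
  rw [Pext_coe R δ t, Pext_zero R δ] at key
  exact key

end Summit.CriticalPhenomena.CardyFormulaZ2.Cruxes.UniformMarginality.HeatFlow

end
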